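import Mathlib
import HarnessLib
import Literature.Algebra.EuclideanLattices.FccBccLattices
import Summits.AtomisticToContinuum.Crystallization.Theorems.PricedLinkCensusSoftLayerPropagationStubMetricDet
import Summits.AtomisticToContinuum.Crystallization.Theorems.PricedLinkCensusSoftLayerPropagationStubMetricScaled
import Summits.AtomisticToContinuum.Crystallization.Theorems.PricedLinkCensusSoftLayerPropagationHXLensB
import Summits.AtomisticToContinuum.Crystallization.Theorems.PricedLinkCensusSoftLayerPropagationHXLensC
import Summits.AtomisticToContinuum.Crystallization.Theorems.PricedLinkCensusSoftLayerPropagationHXHcpVertical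
import Summits.AtomisticToContinuum.Crystallization.Theorems.PricedLinkCensusSoftLayerPropagationHXHcpSkewPoly

/-!
# No second common neighbour of a skew pair (crux `SoftLayerPropagation`, line `Sketch`)

Route `PricedLinkCensus`, crux `SoftLayerPropagation` (stmt-AtomisticToContinuum-14233), line
`Sketch`, helper file for the stub `develop_HX_hcp` (local no-merge at an HCP-type site, SKEW-PAIR
case `|p_u − p_k|² = 11/3`): registered sub-goal `hxh_lens_skew`.

**The lens lemma for a skew pair (unit scale).**  At an HCP-type site `x` let `u₁ = u_30` (upper
triangle) and `l₂ = l_150` (lower triangle) be the skew pair, `p = b_60`, `q = b_120` the basal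
sites between them and `u₂ = u_150`; the two octahedra on the common face `x p q` have the square
diagonals `u₁ q`, `u₂ p` (upper) and `l₂ p` (lower), and `(u₂, l₂)` is the vertical pair over the
face `x q b_180` (so `‖u₂ − l₂‖² ≥ 8/3 − 4α/3 − 27α²` by `Theorems.metric_bipyramid`, `α = 13/200`).
With the twelve squared bonds in `[1, 1 + 13/200]` and the three diagonals in the octahedron
window, no point `t` has `‖t − u₁‖², ‖t − l₂‖² ≤ 1 + 13/200` and `‖t − x‖² ≥ 1`.

Proof.  (1) `skew_sign`: `u₁` and `l₂` lie on opposite sides of the face — the signed volumes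
`det(u₁−x, p−x, q−x)` and `det(l₂−x, p−x, q−x)` have a negative product: by the product formula
`det·det = det(⟪·,·⟫)` (`det3_mul_det3`) and polarisation, `det(u₁−x,·,·)·det(u₂−x,·,·) > 0`
(the bond `u₁ u₂`) and `det(u₂−x,·,·)·det(l₂−x,·,·) < 0` (the separation of the vertical pair).
(2) `hxh_skew_separation`: with `d_U, d_L` these two volumes and `d_n = d_U − d_L` the volume of
`(u₁ − l₂, p − x, q − x)`, `d_U d_L ≤ 0` gives `d_n² ≥ d_U² + d_L² + 2 min(d_U², d_L²)`; the Gram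
expansions `d² = det(Gram)` turn this into `‖u₁ − l₂‖²·G_F ≥ 3 Gram(U) + Gram(L) + Q` (or with
`U, L` exchanged), and the box inequality `hxh_skew_poly` bounds the right-hand side below by
`(327/100) G_F`: so `‖u₁ − l₂‖² ≥ 3.27` (exact value `11/3`).  (3) Euler's quadrilateral inequality
for `x, u₁, t, l₂`: `‖x − t‖² + ‖u₁ − l₂‖² ≤ 4 (1 + 13/200)`, so `‖x − t‖² ≤ 0.99 < 1`.
The distance form at scale `ℓ` (`hxh_lens_skew_dist`) is what `develop_HX_hcp` consumes.
All `[folklore]`.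
-/

noncomputable section

namespace Summit.AtomisticToContinuum.Crystallization.Theorems

open Literature.Geometry.DiscreteGeometry

/-! ### Coordinate identities -/

set_option maxHeartbeats 1600000 in
/-- Linearity of the signed volume in the first slot and the three Gram expansions
`det² = det(Gram)` for `(u₁ − x, p − x, q − x)`, `(l₂ − x, p − x, q − x)`, `(u₁ − l₂, p − x, q − x)`,
with all inner products polarised into the nine squared distances. [folklore] -/
theorem skew_identities (x p q u₁ l₂ : EuclideanSpace ℝ (Fin 3)) :
    Matrix.det ![WithLp.ofLp (u₁ - l₂), WithLp.ofLp (p - x), WithLp.ofLp (q - x)] =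
      Matrix.det ![WithLp.ofLp (u₁ - x), WithLp.ofLp (p - x), WithLp.ofLp (q - x)] -
        Matrix.det ![WithLp.ofLp (l₂ - x), WithLp.ofLp (p - x), WithLp.ofLp (q - x)] ∧
    Matrix.det ![WithLp.ofLp (u₁ - x), WithLp.ofLp (p - x), WithLp.ofLp (q - x)] ^ 2 =
      ‖u₁ - x‖ ^ 2 * ‖p - x‖ ^ 2 * ‖q - x‖ ^ 2 + 2 * ((‖u₁ - x‖ ^ 2 + ‖p - x‖ ^ 2 - ‖u₁ - p‖ ^ 2) / 2) * ((‖u₁ - x‖ ^ 2 + ‖q - x‖ ^ 2 - ‖u₁ - q‖ ^ 2) / 2) * ((‖p - x‖ ^ 2 + ‖q - x‖ ^ 2 - ‖p - q‖ ^ 2) / 2) - ‖u₁ - x‖ ^ 2 * ((‖p - x‖ ^ 2 + ‖q - x‖ ^ 2 - ‖p - q‖ ^ 2) / 2) ^ 2 - ‖p - x‖ ^ 2 * ((‖u₁ - x‖ ^ 2 + ‖q - x‖ ^ 2 - ‖u₁ - q‖ ^ 2) / 2) ^ 2 - ‖q - x‖ ^ 2 * ((‖u₁ - x‖ ^ 2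 + ‖p - x‖ ^ 2 - ‖u₁ - p‖ ^ 2) / 2) ^ 2 ∧
    Matrix.det ![WithLp.ofLp (l₂ - x), WithLp.ofLp (p - x), WithLp.ofLp (q - x)] ^ 2 =
      ‖l₂ - x‖ ^ 2 * ‖p - x‖ ^ 2 * ‖q - x‖ ^ 2 + 2 * ((‖l₂ - x‖ ^ 2 + ‖p - x‖ ^ 2 - ‖l₂ - p‖ ^ 2) / 2) * ((‖l₂ - x‖ ^ 2 + ‖q - x‖ ^ 2 - ‖l₂ - q‖ ^ 2) / 2) * ((‖p - x‖ ^ 2 + ‖q - x‖ ^ 2 - ‖p - q‖ ^ 2) / 2) - ‖l₂ - x‖ ^ 2 * ((‖p - x‖ ^ 2 + ‖q - x‖ ^ 2 - ‖p - q‖ ^ 2) / 2) ^ 2 - ‖p - x‖ ^ 2 * ((‖l₂ - x‖ ^ 2 + ‖q - x‖ ^ 2 - ‖l₂ - q‖ ^ 2) / 2) ^ 2 - ‖q - x‖ ^ 2 * ((‖l₂ - x‖ ^ 2 + ‖p - x‖ ^ 2 - ‖l₂ - p‖ ^ 2) / 2) ^ 2 ∧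
    Matrix.det ![WithLp.ofLp (u₁ - l₂), WithLp.ofLp (p - x), WithLp.ofLp (q - x)] ^ 2 =
      ‖u₁ - l₂‖ ^ 2 * (‖p - x‖ ^ 2 * ‖q - x‖ ^ 2 - ((‖p - x‖ ^ 2 + ‖q - x‖ ^ 2 - ‖p - q‖ ^ 2) / 2) ^ 2) - ((((‖u₁ - x‖ ^ 2 + ‖p - x‖ ^ 2 - ‖u₁ - p‖ ^ 2) / 2) - ((‖l₂ - x‖ ^ 2 + ‖p - x‖ ^ 2 - ‖l₂ - p‖ ^ 2) / 2)) ^ 2 * ‖q - x‖ ^ 2 - 2 * (((‖u₁ - x‖ ^ 2 + ‖p - x‖ ^ 2 - ‖u₁ - p‖ ^ 2) / 2) - ((‖l₂ - x‖ ^ 2 + ‖p - x‖ ^ 2 - ‖l₂ - p‖ ^ 2) / 2)) * (((‖u₁ - x‖ ^ 2 + ‖q - x‖ ^ 2 - ‖u₁ - q‖ ^ 2) / 2) - ((‖l₂ - x‖ ^ 2 + ‖q - x‖ ^ 2 - ‖l₂ - q‖ ^ 2) / 2)) * ((‖p - x‖ ^ 2 + ‖q - x‖ ^ 2 - ‖p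 - q‖ ^ 2) / 2) + (((‖u₁ - x‖ ^ 2 + ‖q - x‖ ^ 2 - ‖u₁ - q‖ ^ 2) / 2) - ((‖l₂ - x‖ ^ 2 + ‖q - x‖ ^ 2 - ‖l₂ - q‖ ^ 2) / 2)) ^ 2 * ‖p - x‖ ^ 2) := by
  simp only [det3_eq, Literature.Algebra.EuclideanLattices.norm_sq_fin_three, PiLp.sub_apply]
  refine ⟨by ring, by ring, by ring, by ring⟩

/-- Euler's quadrilateral identity for `x, u, t, l`: the four sides against the two diagonals.
[folklore] -/
theorem euler_quadrilateral (x u t l : EuclideanSpace ℝ (Fin 3)) :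
    ‖x - u‖ ^ 2 + ‖t - u‖ ^ 2 + ‖t - l‖ ^ 2 + ‖l - x‖ ^ 2 - ‖t - x‖ ^ 2 - ‖u - l‖ ^ 2 =
      ‖x - u + (t - l)‖ ^ 2 := by
  simp only [Literature.Algebra.EuclideanLattices.norm_sq_fin_three, PiLp.sub_apply, PiLp.add_apply]
  ring

/-! ### The two apices lie on opposite sides of the face -/

/-- The product formula for two signed volumes over the common frame `(F₁, F₂)`:
`det(A,F₁,F₂)·det(B,F₁,F₂) = ⟪A,B⟫ G_F − ⟪A,F₁⟫(⟪B,F₁⟫‖F₂‖² − ⟪F₁,F₂⟫⟪B,F₂⟫) + ⟪A,F₂⟫(⟪B,F₁⟫⟪F₁,F₂⟫ − ‖F₁‖²⟪B,F₂⟫)`.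
[folklore] -/
theorem det3_frame_mul (A B F₁ F₂ : EuclideanSpace ℝ (Fin 3)) :
    Matrix.det ![WithLp.ofLp A, WithLp.ofLp F₁, WithLp.ofLp F₂] *
        Matrix.det ![WithLp.ofLp B, WithLp.ofLp F₁, WithLp.ofLp F₂] =
      inner ℝ A B * (‖F₁‖ ^ 2 * ‖F₂‖ ^ 2 - inner ℝ F₁ F₂ * inner ℝ F₁ F₂) -
        inner ℝ A F₁ * (inner ℝ B F₁ * ‖F₂‖ ^ 2 - inner ℝ F₁ F₂ * inner ℝ B F₂) +
        inner ℝ A F₂ * (inner ℝ B F₁ * inner ℝ F₁ F₂ - ‖F₁‖ ^ 2 * inner ℝ B F₂) := by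
  rw [det3_mul_det3, real_inner_comm B F₁, real_inner_comm B F₂, real_inner_comm F₁ F₂,
    real_inner_self_eq_norm_sq, real_inner_self_eq_norm_sq]

/-- The two brackets of the product formula for an apex vector `B` of diagonal type over `F₁` and
bond type over `F₂`: `W = ⟪B,F₁⟫‖F₂‖² − ⟪F₁,F₂⟫⟪B,F₂⟫ ∈ [−0.4713, −0.056]` and
`Z = ⟪B,F₁⟫⟪F₁,F₂⟫ − ‖F₁‖²⟪B,F₂⟫ ∈ [−0.6824, −0.3815]`. [folklore] -/
theorem skew_brackets {f₁ f₂ g b₁ b₂ : ℝ}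
    (hf₁ : 1 ≤ f₁) (hf₁' : f₁ ≤ 213 / 200) (hf₂ : 1 ≤ f₂) (hf₂' : f₂ ≤ 213 / 200)
    (hg : 187 / 400 ≤ g) (hg' : g ≤ 113 / 200)
    (hb₁ : -(1427 / 10000) ≤ b₁) (hb₁' : b₁ ≤ 1522 / 10000) (hb₂ : 187 / 400 ≤ b₂) (hb₂' : b₂ ≤ 113 / 200) :
    (-(4713 / 10000) ≤ b₁ * f₂ - g * b₂ ∧ b₁ * f₂ - g * b₂ ≤ -(56 / 1000)) ∧
    (-(6824 / 10000) ≤ b₁ * g - f₁ * b₂ ∧ b₁ * g - f₁ * b₂ ≤ -(3815 / 10000)) := by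
  have w1 : b₁ * f₂ ≤ 1522 / 10000 * f₂ := mul_le_mul_of_nonneg_right hb₁' (by linarith)
  have w2 : -(1427 / 10000) * f₂ ≤ b₁ * f₂ := mul_le_mul_of_nonneg_right hb₁ (by linarith)
  have w3 : 187 / 400 * (187 / 400) ≤ g * b₂ := mul_le_mul hg hb₂ (by norm_num) (by linarith)
  have w4 : g * b₂ ≤ 113 / 200 * (113 / 200) := mul_le_mul hg' hb₂' (by linarith) (by norm_num)
  have z1 : b₁ * g ≤ 1522 / 10000 * g := mul_le_mul_of_nonneg_right hb₁' (by linarith)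
  have z2 : -(1427 / 10000) * g ≤ b₁ * g := mul_le_mul_of_nonneg_right hb₁ (by linarith)
  have z3 : 1 * (187 / 400) ≤ f₁ * b₂ := mul_le_mul hf₁ hb₂ (by norm_num) (by linarith)
  have z4 : f₁ * b₂ ≤ 213 / 200 * (113 / 200) := mul_le_mul hf₁' hb₂' (by linarith) (by norm_num)
  exact ⟨⟨by linarith, by linarith⟩, ⟨by linarith, by linarith⟩⟩

/-- **Same side.**  Frame `F₁, F₂` of a near-unit contact triangle, an apex vector `A` of bond
type over `F₁` and diagonal type over `F₂`, an apex vector `B` the other way round, and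
`⟪A, B⟫ ≥ 187/400` (a bond): the two signed volumes have a positive product. [folklore] -/
theorem skew_same_side (A B F₁ F₂ : EuclideanSpace ℝ (Fin 3))
    (hf₁ : 1 ≤ ‖F₁‖ ^ 2) (hf₁' : ‖F₁‖ ^ 2 ≤ 213 / 200) (hf₂ : 1 ≤ ‖F₂‖ ^ 2) (hf₂' : ‖F₂‖ ^ 2 ≤ 213 / 200)
    (hg : 187 / 400 ≤ inner ℝ F₁ F₂) (hg' : inner ℝ F₁ F₂ ≤ 113 / 200)
    (ha₁ : 187 / 400 ≤ inner ℝ A F₁) (_ha₁' : inner ℝ A F₁ ≤ 113 / 200)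
    (_ha₂ : -(1427 / 10000) ≤ inner ℝ A F₂) (ha₂' : inner ℝ A F₂ ≤ 1522 / 10000)
    (hb₁ : -(1427 / 10000) ≤ inner ℝ B F₁) (hb₁' : inner ℝ B F₁ ≤ 1522 / 10000)
    (hb₂ : 187 / 400 ≤ inner ℝ B F₂) (hb₂' : inner ℝ B F₂ ≤ 113 / 200)
    (hσ : 187 / 400 ≤ inner ℝ A B) :
    0 < Matrix.det ![WithLp.ofLp A, WithLp.ofLp F₁, WithLp.ofLp F₂] *
      Matrix.det ![WithLp.ofLp B, WithLp.ofLp F₁, WithLp.ofLp F₂] := by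
  rw [det3_frame_mul]
  obtain ⟨⟨Wlo, Whi⟩, ⟨Zlo, Zhi⟩⟩ := skew_brackets hf₁ hf₁' hf₂ hf₂' hg hg' hb₁ hb₁' hb₂ hb₂'
  generalize inner ℝ A B = σ at *
  generalize inner ℝ F₁ F₂ = g at *
  generalize inner ℝ A F₁ = a₁ at *
  generalize inner ℝ A F₂ = a₂ at *
  generalize inner ℝ B F₁ = b₁ at *
  generalize inner ℝ B F₂ = b₂ at *
  generalize ‖F₁‖ ^ 2 = f₁ at *
  generalize ‖F₂‖ ^ 2 = f₂ at *
  have hgg : g * g ≤ 113 / 200 * (113 / 200) := mul_le_mul hg' hg' (by linarith) (by norm_num)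
  have hff : 1 ≤ f₁ * f₂ := one_le_mul_of_one_le_of_one_le hf₁ hf₂
  have hGF : 68 / 100 ≤ f₁ * f₂ - g * g := by linarith
  have t1 : 187 / 400 * (68 / 100) ≤ σ * (f₁ * f₂ - g * g) :=
    mul_le_mul hσ hGF (by norm_num) (by linarith)
  have t2 : a₁ * (b₁ * f₂ - g * b₂) ≤ 187 / 400 * (b₁ * f₂ - g * b₂) := by
    have := mul_nonpos_of_nonneg_of_nonpos (sub_nonneg.2 ha₁) (by linarith : b₁ * f₂ - g * b₂ ≤ 0)
    linarith
  have t3 : 1522 / 10000 * (b₁ * g - f₁ * b₂) ≤ a₂ * (b₁ * g - f₁ * b₂) := by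
    have := mul_nonneg_of_nonpos_of_nonpos (sub_nonpos.2 ha₂') (by linarith : b₁ * g - f₁ * b₂ ≤ 0)
    linarith
  linarith

/-- **Opposite sides.**  Frame as above, two apex vectors `A, B` both of diagonal type over `F₁`
and bond type over `F₂`, and `⟪A, B⟫ ≤ −0.1679` (the separated vertical pair): the two signed
volumes have a negative product. [folklore] -/
theorem skew_opposite_side (A B F₁ F₂ : EuclideanSpace ℝ (Fin 3))
    (hf₁ : 1 ≤ ‖F₁‖ ^ 2) (hf₁' : ‖F₁‖ ^ 2 ≤ 213 / 200) (hf₂ : 1 ≤ ‖F₂‖ ^ 2) (hf₂' : ‖F₂‖ ^ 2 ≤ 213 / 200)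
    (hg : 187 / 400 ≤ inner ℝ F₁ F₂) (hg' : inner ℝ F₁ F₂ ≤ 113 / 200)
    (_ha₁ : -(1427 / 10000) ≤ inner ℝ A F₁) (ha₁' : inner ℝ A F₁ ≤ 1522 / 10000)
    (ha₂ : 187 / 400 ≤ inner ℝ A F₂) (_ha₂' : inner ℝ A F₂ ≤ 113 / 200)
    (hb₁ : -(1427 / 10000) ≤ inner ℝ B F₁) (hb₁' : inner ℝ B F₁ ≤ 1522 / 10000)
    (hb₂ : 187 / 400 ≤ inner ℝ B F₂) (hb₂' : inner ℝ B F₂ ≤ 113 / 200)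
    (hσ : inner ℝ A B ≤ -(1679 / 10000)) :
    Matrix.det ![WithLp.ofLp A, WithLp.ofLp F₁, WithLp.ofLp F₂] *
      Matrix.det ![WithLp.ofLp B, WithLp.ofLp F₁, WithLp.ofLp F₂] < 0 := by
  rw [det3_frame_mul]
  obtain ⟨⟨Wlo, Whi⟩, ⟨Zlo, Zhi⟩⟩ := skew_brackets hf₁ hf₁' hf₂ hf₂' hg hg' hb₁ hb₁' hb₂ hb₂'
  generalize inner ℝ A B = σ at *
  generalize inner ℝ F₁ F₂ = g at *
  generalize inner ℝ A F₁ = a₁ at *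
  generalize inner ℝ A F₂ = a₂ at *
  generalize inner ℝ B F₁ = b₁ at *
  generalize inner ℝ B F₂ = b₂ at *
  generalize ‖F₁‖ ^ 2 = f₁ at *
  generalize ‖F₂‖ ^ 2 = f₂ at *
  have hgg : g * g ≤ 113 / 200 * (113 / 200) := mul_le_mul hg' hg' (by linarith) (by norm_num)
  have hff : 1 ≤ f₁ * f₂ := one_le_mul_of_one_le_of_one_le hf₁ hf₂
  have hGF : 68 / 100 ≤ f₁ * f₂ - g * g := by linarith
  have t1a : σ * (f₁ * f₂ - g * g) ≤ -(1679 / 10000) * (f₁ * f₂ - g * g) :=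
    mul_le_mul_of_nonneg_right hσ (by linarith)
  have t1 : σ * (f₁ * f₂ - g * g) ≤ -(1679 / 10000) * (68 / 100) := by linarith
  have t2 : 1522 / 10000 * (b₁ * f₂ - g * b₂) ≤ a₁ * (b₁ * f₂ - g * b₂) := by
    have := mul_nonneg_of_nonpos_of_nonpos (sub_nonpos.2 ha₁') (by linarith : b₁ * f₂ - g * b₂ ≤ 0)
    linarith
  have t3 : a₂ * (b₁ * g - f₁ * b₂) ≤ 187 / 400 * (b₁ * g - f₁ * b₂) := by
    have := mul_nonpos_of_nonneg_of_nonpos (sub_nonneg.2 ha₂) (by linarith : b₁ * g - f₁ * b₂ ≤ 0)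
    linarith
  linarith


/-- **`skew_sign`: the apices `u₁` (upper) and `l₂` (lower) lie on opposite sides of the face
`x p q`.**  Bonds `p x, q x, p q, u₁ x, u₁ p, u₂ x, u₂ q, u₁ u₂, l₂ x, l₂ q`, diagonals `u₁ q, u₂ p, l₂ p`
in the octahedron window, and the vertical pair `u₂ l₂` separated as in the bipyramid lemma: then
`det(u₁ − x, p − x, q − x) · det(l₂ − x, p − x, q − x) < 0`. [folklore] -/
theorem skew_sign (x p q u₁ u₂ l₂ : EuclideanSpace ℝ (Fin 3))
    (hpx : 1 ≤ ‖p - x‖ ^ 2) (hpx' : ‖p - x‖ ^ 2 ≤ 1 + 13 / 200) (hqx : 1 ≤ ‖q - x‖ ^ 2)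
    (hqx' : ‖q - x‖ ^ 2 ≤ 1 + 13 / 200) (hpq : 1 ≤ ‖p - q‖ ^ 2) (hpq' : ‖p - q‖ ^ 2 ≤ 1 + 13 / 200)
    (hu1x : 1 ≤ ‖u₁ - x‖ ^ 2) (hu1x' : ‖u₁ - x‖ ^ 2 ≤ 1 + 13 / 200) (hu1p : 1 ≤ ‖u₁ - p‖ ^ 2)
    (hu1p' : ‖u₁ - p‖ ^ 2 ≤ 1 + 13 / 200) (hu1q : 2 - 2 * (13 / 200) - 21 / 2 * (13 / 200) ^ 2 ≤ ‖u₁ - q‖ ^ 2)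
    (hu1q' : ‖u₁ - q‖ ^ 2 ≤ 2 + 4 * (13 / 200) + 6 * (13 / 200) ^ 2)
    (hu2x : 1 ≤ ‖u₂ - x‖ ^ 2) (hu2x' : ‖u₂ - x‖ ^ 2 ≤ 1 + 13 / 200) (hu2q : 1 ≤ ‖u₂ - q‖ ^ 2)
    (hu2q' : ‖u₂ - q‖ ^ 2 ≤ 1 + 13 / 200) (hu2p : 2 - 2 * (13 / 200) - 21 / 2 * (13 / 200) ^ 2 ≤ ‖u₂ - p‖ ^ 2)
    (hu2p' : ‖u₂ - p‖ ^ 2 ≤ 2 + 4 * (13 / 200) + 6 * (13 / 200) ^ 2) (_hu12 : 1 ≤ ‖u₁ - u₂‖ ^ 2)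
    (hu12' : ‖u₁ - u₂‖ ^ 2 ≤ 1 + 13 / 200)
    (hl2x : 1 ≤ ‖l₂ - x‖ ^ 2) (hl2x' : ‖l₂ - x‖ ^ 2 ≤ 1 + 13 / 200) (hl2q : 1 ≤ ‖l₂ - q‖ ^ 2)
    (hl2q' : ‖l₂ - q‖ ^ 2 ≤ 1 + 13 / 200) (hl2p : 2 - 2 * (13 / 200) - 21 / 2 * (13 / 200) ^ 2 ≤ ‖l₂ - p‖ ^ 2)
    (hl2p' : ‖l₂ - p‖ ^ 2 ≤ 2 + 4 * (13 / 200) + 6 * (13 / 200) ^ 2)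
    (hV : 8 / 3 - 4 / 3 * (13 / 200) - 27 * (13 / 200) ^ 2 ≤ ‖u₂ - l₂‖ ^ 2) :
    Matrix.det ![WithLp.ofLp (u₁ - x), WithLp.ofLp (p - x), WithLp.ofLp (q - x)] *
      Matrix.det ![WithLp.ofLp (l₂ - x), WithLp.ofLp (p - x), WithLp.ofLp (q - x)] < 0 := by
  norm_num at hpx' hqx' hpq' hu1x' hu1p' hu2x' hu2q' hu12' hl2x' hl2q' hu1q hu1q' hu2p hu2p' hl2p hl2p' hV
  -- polarisation of the frame data
  have P : ∀ a b : EuclideanSpace ℝ (Fin 3),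
      inner ℝ (a - x) (b - x) = (‖a - x‖ ^ 2 + ‖b - x‖ ^ 2 - ‖a - b‖ ^ 2) / 2 := by
    intro a b
    rw [inner_eq_of_norm_sub, sub_sub_sub_cancel_right]
  have g1 : 187 / 400 ≤ inner ℝ (p - x) (q - x) := by rw [P]; linarith
  have g2 : inner ℝ (p - x) (q - x) ≤ 113 / 200 := by rw [P]; linarith
  -- `u₁`: bond over `p`, diagonal over `q`
  have a1 : 187 / 400 ≤ inner ℝ (u₁ - x) (p - x) := by rw [P]; linarith
  have a1' : inner ℝ (u₁ - x) (p - x) ≤ 113 / 200 := by rw [P]; linarith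
  have a2 : -(1427 / 10000) ≤ inner ℝ (u₁ - x) (q - x) := by rw [P]; linarith
  have a2' : inner ℝ (u₁ - x) (q - x) ≤ 1522 / 10000 := by rw [P]; linarith
  -- `u₂`: diagonal over `p`, bond over `q`
  have b1 : -(1427 / 10000) ≤ inner ℝ (u₂ - x) (p - x) := by rw [P]; linarith
  have b1' : inner ℝ (u₂ - x) (p - x) ≤ 1522 / 10000 := by rw [P]; linarith
  have b2 : 187 / 400 ≤ inner ℝ (u₂ - x) (q - x) := by rw [P]; linarith
  have b2' : inner ℝ (u₂ - x) (q - x) ≤ 113 / 200 := by rw [P]; linarith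
  -- `l₂`: diagonal over `p`, bond over `q`
  have c1 : -(1427 / 10000) ≤ inner ℝ (l₂ - x) (p - x) := by rw [P]; linarith
  have c1' : inner ℝ (l₂ - x) (p - x) ≤ 1522 / 10000 := by rw [P]; linarith
  have c2 : 187 / 400 ≤ inner ℝ (l₂ - x) (q - x) := by rw [P]; linarith
  have c2' : inner ℝ (l₂ - x) (q - x) ≤ 113 / 200 := by rw [P]; linarith
  -- the bond `u₁ u₂` and the separated pair `u₂ l₂`
  have s12 : 187 / 400 ≤ inner ℝ (u₁ - x) (u₂ - x) := by rw [P]; linarith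
  have s23 : inner ℝ (u₂ - x) (l₂ - x) ≤ -(1679 / 10000) := by rw [P]; linarith
  have pos := skew_same_side (u₁ - x) (u₂ - x) (p - x) (q - x) hpx hpx' hqx hqx' g1 g2 a1 a1' a2 a2'
    b1 b1' b2 b2' s12
  have neg := skew_opposite_side (u₂ - x) (l₂ - x) (p - x) (q - x) hpx hpx' hqx hqx' g1 g2 b1 b1'
    b2 b2' c1 c1' c2 c2' s23
  generalize Matrix.det ![WithLp.ofLp (u₁ - x), WithLp.ofLp (p - x), WithLp.ofLp (q - x)] = d₁ at *
  generalize Matrix.det ![WithLp.ofLp (u₂ - x), WithLp.ofLp (p - x), WithLp.ofLp (q - x)] = d₂ at *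
  generalize Matrix.det ![WithLp.ofLp (l₂ - x), WithLp.ofLp (p - x), WithLp.ofLp (q - x)] = d₃ at *
  have key : (d₁ * d₂) * (d₂ * d₃) = d₂ ^ 2 * (d₁ * d₃) := by ring
  have hlt : d₂ ^ 2 * (d₁ * d₃) < 0 := by rw [← key]; exact mul_neg_of_pos_of_neg pos neg
  by_contra hge
  push Not at hge
  exact absurd hlt (not_lt.2 (mul_nonneg (sq_nonneg _) hge))

/-! ### The separation of a skew pair -/

set_option maxHeartbeats 800000 in
/-- **`hxh_skew_separation`: a skew pair is `≥ √3.27` apart.**  Face bonds `p x, q x, p q`, the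
bonds `u₁ x, u₁ p, l₂ x, l₂ q`, the diagonals `u₁ q, l₂ p` in the octahedron window, and `u₁, l₂` on
opposite sides of the face (`det · det ≤ 0`): then `‖u₁ − l₂‖² ≥ 327/100`. [folklore] -/
theorem hxh_skew_separation (x p q u₁ l₂ : EuclideanSpace ℝ (Fin 3))
    (hpx : 1 ≤ ‖p - x‖ ^ 2) (hpx' : ‖p - x‖ ^ 2 ≤ 1 + 13 / 200) (hqx : 1 ≤ ‖q - x‖ ^ 2)
    (hqx' : ‖q - x‖ ^ 2 ≤ 1 + 13 / 200) (hpq : 1 ≤ ‖p - q‖ ^ 2) (hpq' : ‖p - q‖ ^ 2 ≤ 1 + 13 / 200)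
    (hu1x : 1 ≤ ‖u₁ - x‖ ^ 2) (hu1x' : ‖u₁ - x‖ ^ 2 ≤ 1 + 13 / 200) (hu1p : 1 ≤ ‖u₁ - p‖ ^ 2)
    (hu1p' : ‖u₁ - p‖ ^ 2 ≤ 1 + 13 / 200) (hu1q : 2 - 2 * (13 / 200) - 21 / 2 * (13 / 200) ^ 2 ≤ ‖u₁ - q‖ ^ 2)
    (hu1q' : ‖u₁ - q‖ ^ 2 ≤ 2 + 4 * (13 / 200) + 6 * (13 / 200) ^ 2)
    (hl2x : 1 ≤ ‖l₂ - x‖ ^ 2) (hl2x' : ‖l₂ - x‖ ^ 2 ≤ 1 + 13 / 200) (hl2q : 1 ≤ ‖l₂ - q‖ ^ 2)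
    (hl2q' : ‖l₂ - q‖ ^ 2 ≤ 1 + 13 / 200) (hl2p : 2 - 2 * (13 / 200) - 21 / 2 * (13 / 200) ^ 2 ≤ ‖l₂ - p‖ ^ 2)
    (hl2p' : ‖l₂ - p‖ ^ 2 ≤ 2 + 4 * (13 / 200) + 6 * (13 / 200) ^ 2)
    (hsign : Matrix.det ![WithLp.ofLp (u₁ - x), WithLp.ofLp (p - x), WithLp.ofLp (q - x)] *
      Matrix.det ![WithLp.ofLp (l₂ - x), WithLp.ofLp (p - x), WithLp.ofLp (q - x)] ≤ 0) :
    327 / 100 ≤ ‖u₁ - l₂‖ ^ 2 := by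
  -- the frame Gram determinant is positive
  have hg : ((‖p - x‖ ^ 2 + ‖q - x‖ ^ 2 - ‖p - q‖ ^ 2) / 2) ^ 2 ≤ (113 / 200) ^ 2 :=
    pow_le_pow_left₀ (by linarith) (by linarith) 2
  have hff : 1 ≤ ‖p - x‖ ^ 2 * ‖q - x‖ ^ 2 := one_le_mul_of_one_le_of_one_le hpx hqx
  have GFpos : 0 < (‖p - x‖ ^ 2 * ‖q - x‖ ^ 2 - ((‖p - x‖ ^ 2 + ‖q - x‖ ^ 2 - ‖p - q‖ ^ 2) / 2) ^ 2) := by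
    have h9 : ((113 : ℝ) / 200) ^ 2 < 1 := by norm_num
    linarith only [hff, hg, h9]
  obtain ⟨lin, iU, iL, iN⟩ := skew_identities x p q u₁ l₂
  have P1 := hxh_skew_poly (‖p - x‖ ^ 2) (‖q - x‖ ^ 2) (‖p - q‖ ^ 2) (‖u₁ - x‖ ^ 2) (‖u₁ - p‖ ^ 2)
    (‖u₁ - q‖ ^ 2) (‖l₂ - x‖ ^ 2) (‖l₂ - q‖ ^ 2) (‖l₂ - p‖ ^ 2) hpx hpx' hqx hqx' hpq hpq' hu1x hu1x'
    hu1p hu1p' hu1q hu1q' hl2x hl2x' hl2q hl2q' hl2p hl2p'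
  have P2 := hxh_skew_poly (‖q - x‖ ^ 2) (‖p - x‖ ^ 2) (‖p - q‖ ^ 2) (‖l₂ - x‖ ^ 2) (‖l₂ - q‖ ^ 2)
    (‖l₂ - p‖ ^ 2) (‖u₁ - x‖ ^ 2) (‖u₁ - p‖ ^ 2) (‖u₁ - q‖ ^ 2) hqx hqx' hpx hpx' hpq hpq' hl2x hl2x'
    hl2q hl2q' hl2p hl2p' hu1x hu1x' hu1p hu1p' hu1q hu1q'
  generalize hdU : Matrix.det ![WithLp.ofLp (u₁ - x), WithLp.ofLp (p - x), WithLp.ofLp (q - x)] = dU at *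
  generalize hdL : Matrix.det ![WithLp.ofLp (l₂ - x), WithLp.ofLp (p - x), WithLp.ofLp (q - x)] = dL at *
  generalize hdn : Matrix.det ![WithLp.ofLp (u₁ - l₂), WithLp.ofLp (p - x), WithLp.ofLp (q - x)] = dn at *
  have hprod : 0 ≤ -(dU * dL) := by linarith only [hsign]
  have hdn2 : dn ^ 2 = dU ^ 2 + dL ^ 2 + 2 * (-(dU * dL)) := by rw [lin]; ring
  -- `‖u₁ − l₂‖² · G_F ≥ (327/100) · G_F`
  have main : 327 / 100 * (‖p - x‖ ^ 2 * ‖q - x‖ ^ 2 - ((‖p - x‖ ^ 2 + ‖q - x‖ ^ 2 - ‖p - q‖ ^ 2) / 2) ^ 2) ≤ ‖u₁ - l₂‖ ^ 2 * (‖p - x‖ ^ 2 * ‖q - x‖ ^ 2 - ((‖p - x‖ ^ 2 + ‖q - x‖ ^ 2 - ‖p - q‖ ^ 2) / 2) ^ 2) := by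
    rcases le_total (dU ^ 2) (dL ^ 2) with h | h
    · have h1 : (dU ^ 2) ^ 2 ≤ (-(dU * dL)) ^ 2 :=
        calc (dU ^ 2) ^ 2 = dU ^ 2 * dU ^ 2 := by ring
          _ ≤ dU ^ 2 * dL ^ 2 := mul_le_mul_of_nonneg_left h (sq_nonneg dU)
          _ = (-(dU * dL)) ^ 2 := by ring
      have h2 : dU ^ 2 ≤ -(dU * dL) := (pow_le_pow_iff_left₀ (sq_nonneg dU) hprod two_ne_zero).1 h1
      have h3 : 3 * dU ^ 2 + dL ^ 2 ≤ dn ^ 2 := by linarith only [hdn2, h2]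
      linarith only [P1, iU, iL, iN, h3]
    · have h1 : (dL ^ 2) ^ 2 ≤ (-(dU * dL)) ^ 2 :=
        calc (dL ^ 2) ^ 2 = dL ^ 2 * dL ^ 2 := by ring
          _ ≤ dL ^ 2 * dU ^ 2 := mul_le_mul_of_nonneg_left h (sq_nonneg dL)
          _ = (-(dU * dL)) ^ 2 := by ring
      have h2 : dL ^ 2 ≤ -(dU * dL) := (pow_le_pow_iff_left₀ (sq_nonneg dL) hprod two_ne_zero).1 h1
      have h3 : dU ^ 2 + 3 * dL ^ 2 ≤ dn ^ 2 := by linarith only [hdn2, h2]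
      linarith only [P2, iU, iL, iN, h3]
  by_contra hlt
  push Not at hlt
  exact absurd main (not_le.2 (mul_lt_mul_of_pos_right hlt GFpos))

/-! ### The lens lemma -/

/-- **Registered sub-goal `hxh_lens_skew`: the lens lemma for a skew pair, unit scale.**  Points
`x p q u₁ u₂ l₂ t` with the twelve squared bonds `p x, q x, p q, u₁ x, u₁ p, u₂ x, u₂ q, u₁ u₂, l₂ x,
l₂ q, t u₁, t l₂` in `[1, 1 + 13/200]`, the three diagonals `u₁ q, u₂ p, l₂ p` in the octahedron window,
the vertical pair `u₂ l₂` separated as in the bipyramid lemma, and `‖t − x‖² ≥ 1`: impossible.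
[folklore] -/
theorem hxh_lens_skew : ∀ (x p q u₁ u₂ l₂ t : EuclideanSpace ℝ (Fin 3)), 1 ≤ ‖p - x‖ ^ 2 → ‖p - x‖ ^ 2 ≤ 1 + 13 / 200 → 1 ≤ ‖q - x‖ ^ 2 → ‖q - x‖ ^ 2 ≤ 1 + 13 / 200 → 1 ≤ ‖p - q‖ ^ 2 → ‖p - q‖ ^ 2 ≤ 1 + 13 / 200 → 1 ≤ ‖u₁ - x‖ ^ 2 → ‖u₁ - x‖ ^ 2 ≤ 1 + 13 / 200 → 1 ≤ ‖u₁ - p‖ ^ 2 → ‖u₁ - p‖ ^ 2 ≤ 1 + 13 / 200 → 2 - 2 * (13 / 200) - 21 / 2 * (13 / 200) ^ 2 ≤ ‖u₁ - q‖ ^ 2 → ‖u₁ - q‖ ^ 2 ≤ 2 + 4 * (13 / 200) + 6 * (13 / 200) ^ 2 → 1 ≤ ‖u₂ - x‖ ^ 2 → ‖u₂ - x‖ ^ 2 ≤ 1 + 13 / 200 → 1 ≤ ‖u₂ - q‖ ^ 2 → ‖u₂ - q‖ ^ 2 ≤ 1 + 13 / 200 → 2 - 2 * (13 / 200) - 21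 / 2 * (13 / 200) ^ 2 ≤ ‖u₂ - p‖ ^ 2 → ‖u₂ - p‖ ^ 2 ≤ 2 + 4 * (13 / 200) + 6 * (13 / 200) ^ 2 → 1 ≤ ‖u₁ - u₂‖ ^ 2 → ‖u₁ - u₂‖ ^ 2 ≤ 1 + 13 / 200 → 1 ≤ ‖l₂ - x‖ ^ 2 → ‖l₂ - x‖ ^ 2 ≤ 1 + 13 / 200 → 1 ≤ ‖l₂ - q‖ ^ 2 → ‖l₂ - q‖ ^ 2 ≤ 1 + 13 / 200 → 2 - 2 * (13 / 200) - 21 / 2 * (13 / 200) ^ 2 ≤ ‖l₂ - p‖ ^ 2 → ‖l₂ - p‖ ^ 2 ≤ 2 + 4 * (13 / 200) + 6 * (13 / 200) ^ 2 → 8 / 3 - 4 / 3 * (13 / 200) - 27 * (13 / 200) ^ 2 ≤ ‖u₂ - l₂‖ ^ 2 → 1 ≤ ‖t - u₁‖ ^ 2 → ‖t - u₁‖ ^ 2 ≤ 1 + 13 / 200 → 1 ≤ ‖t - l₂‖ ^ 2 → ‖t - l₂‖ ^ 2 ≤ 1 + 13 / 200 → 1 ≤ ‖t - x‖ ^ 2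 → False := by
  intro x p q u₁ u₂ l₂ t hpx hpx' hqx hqx' hpq hpq' hu1x hu1x' hu1p hu1p' hu1q hu1q' hu2x hu2x' hu2q hu2q'
    hu2p hu2p' hu12 hu12' hl2x hl2x' hl2q hl2q' hl2p hl2p' hV htu htu' htl htl' htx
  have hsign := skew_sign x p q u₁ u₂ l₂ hpx hpx' hqx hqx' hpq hpq' hu1x hu1x' hu1p hu1p' hu1q hu1q'
    hu2x hu2x' hu2q hu2q' hu2p hu2p' hu12 hu12' hl2x hl2x' hl2q hl2q' hl2p hl2p' hV
  have hsep := hxh_skew_separation x p q u₁ l₂ hpx hpx' hqx hqx' hpq hpq' hu1x hu1x' hu1p hu1p' hu1q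
    hu1q' hl2x hl2x' hl2q hl2q' hl2p hl2p' hsign.le
  have euler := euler_quadrilateral x u₁ t l₂
  rw [norm_sub_rev x u₁] at euler
  nlinarith only [euler, sq_nonneg ‖x - u₁ + (t - l₂)‖, hu1x', htu', htl', hl2x', htx, hsep]

/-- **The lens lemma for a skew pair at scale `ℓ`, distance form.**  The twelve bonds in
`[ℓ, (1+ε)ℓ]` (`ε ≤ 1/32`), the three square diagonals in the window of
`Theorems.metric_octahedron_dist` and the vertical pair in the window of
`Theorems.metric_bipyramid_dist` (`α = 2ε + ε²`), and `dist t x ≥ ℓ`: impossible. [folklore] -/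
theorem hxh_lens_skew_dist : ∀ ε ℓ : ℝ, 0 ≤ ε → ε ≤ 1 / 32 → 0 < ℓ →
    ∀ (x p q u₁ u₂ l₂ t : EuclideanSpace ℝ (Fin 3)),
      ℓ ≤ dist p x → dist p x ≤ (1 + ε) * ℓ → ℓ ≤ dist q x → dist q x ≤ (1 + ε) * ℓ →
      ℓ ≤ dist p q → dist p q ≤ (1 + ε) * ℓ →
      ℓ ≤ dist u₁ x → dist u₁ x ≤ (1 + ε) * ℓ → ℓ ≤ dist u₁ p → dist u₁ p ≤ (1 + ε) * ℓ →
      (2 - 2 * (2 * ε + ε ^ 2) - 21 / 2 * (2 * ε + ε ^ 2) ^ 2) * ℓ ^ 2 ≤ dist u₁ q ^ 2 →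
      dist u₁ q ^ 2 ≤ (2 + 4 * (2 * ε + ε ^ 2) + 6 * (2 * ε + ε ^ 2) ^ 2) * ℓ ^ 2 →
      ℓ ≤ dist u₂ x → dist u₂ x ≤ (1 + ε) * ℓ → ℓ ≤ dist u₂ q → dist u₂ q ≤ (1 + ε) * ℓ →
      (2 - 2 * (2 * ε + ε ^ 2) - 21 / 2 * (2 * ε + ε ^ 2) ^ 2) * ℓ ^ 2 ≤ dist u₂ p ^ 2 →
      dist u₂ p ^ 2 ≤ (2 + 4 * (2 * ε + ε ^ 2) + 6 * (2 * ε + ε ^ 2) ^ 2) * ℓ ^ 2 →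
      ℓ ≤ dist u₁ u₂ → dist u₁ u₂ ≤ (1 + ε) * ℓ →
      ℓ ≤ dist l₂ x → dist l₂ x ≤ (1 + ε) * ℓ → ℓ ≤ dist l₂ q → dist l₂ q ≤ (1 + ε) * ℓ →
      (2 - 2 * (2 * ε + ε ^ 2) - 21 / 2 * (2 * ε + ε ^ 2) ^ 2) * ℓ ^ 2 ≤ dist l₂ p ^ 2 →
      dist l₂ p ^ 2 ≤ (2 + 4 * (2 * ε + ε ^ 2) + 6 * (2 * ε + ε ^ 2) ^ 2) * ℓ ^ 2 →
      (8 / 3 - 4 / 3 * (2 * ε + ε ^ 2) - 27 * (2 * ε + ε ^ 2) ^ 2) * ℓ ^ 2 ≤ dist u₂ l₂ ^ 2 →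
      dist u₂ l₂ ^ 2 ≤ (8 / 3 + 4 * (2 * ε + ε ^ 2)) * ℓ ^ 2 →
      ℓ ≤ dist t u₁ → dist t u₁ ≤ (1 + ε) * ℓ → ℓ ≤ dist t l₂ → dist t l₂ ≤ (1 + ε) * ℓ →
      ℓ ≤ dist t x → False := by
  intro ε ℓ hε hε' hℓ x p q u₁ u₂ l₂ t hpx hpx' hqx hqx' hpq hpq' hu1x hu1x' hu1p hu1p' hu1q hu1q'
    hu2x hu2x' hu2q hu2q' hu2p hu2p' hu12 hu12' hl2x hl2x' hl2q hl2q' hl2p hl2p' hV hV' htu htu'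
    htl htl' htx
  have W := fun {a b : EuclideanSpace ℝ (Fin 3)} (h₁ : ℓ ≤ dist a b) (h₂ : dist a b ≤ (1 + ε) * ℓ) =>
    window_rescale_13 hℓ hε hε' h₁ h₂
  have D := fun {a b : EuclideanSpace ℝ (Fin 3)}
      (h₁ : (2 - 2 * (2 * ε + ε ^ 2) - 21 / 2 * (2 * ε + ε ^ 2) ^ 2) * ℓ ^ 2 ≤ dist a b ^ 2)
      (h₂ : dist a b ^ 2 ≤ (2 + 4 * (2 * ε + ε ^ 2) + 6 * (2 * ε + ε ^ 2) ^ 2) * ℓ ^ 2) =>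
    diag_window_rescale hℓ hε hε' h₁ h₂
  obtain ⟨vlo, -⟩ := vert_window_rescale hℓ hε hε' hV hV'
  exact hxh_lens_skew (ℓ⁻¹ • x) (ℓ⁻¹ • p) (ℓ⁻¹ • q) (ℓ⁻¹ • u₁) (ℓ⁻¹ • u₂) (ℓ⁻¹ • l₂) (ℓ⁻¹ • t)
    (W hpx hpx').1 (W hpx hpx').2 (W hqx hqx').1 (W hqx hqx').2 (W hpq hpq').1 (W hpq hpq').2
    (W hu1x hu1x').1 (W hu1x hu1x').2 (W hu1p hu1p').1 (W hu1p hu1p').2 (D hu1q hu1q').1 (D hu1q hu1q').2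
    (W hu2x hu2x').1 (W hu2x hu2x').2 (W hu2q hu2q').1 (W hu2q hu2q').2 (D hu2p hu2p').1 (D hu2p hu2p').2
    (W hu12 hu12').1 (W hu12 hu12').2 (W hl2x hl2x').1 (W hl2x hl2x').2 (W hl2q hl2q').1 (W hl2q hl2q').2
    (D hl2p hl2p').1 (D hl2p hl2p').2 vlo (W htu htu').1 (W htu htu').2 (W htl htl').1 (W htl htl').2
    (floor_rescale hℓ htx)

end Summit.AtomisticToContinuum.Crystallization.Theorems

end
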